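import Summits.Ventures.LatticeQCDFlow.TrivializingMaps.WilsonGradientBound
import Summits.Ventures.LatticeQCDFlow.TrivializingMaps.WilsonNonInteractingLinks
import Summits.Ventures.LatticeQCDFlow.TrivializingMaps.WilsonMeasureTrivializingMap
import Summits.Ventures.LatticeQCDFlow.TrivializingMaps.StaircaseMeanActionLaw
import Summits.Ventures.LatticeQCDFlow.TrivializingMaps.SuBasisExistence
import Summits.Ventures.LatticeQCDFlow.TrivializingMaps.HaarByPartsZeroModes
import Literature.MathematicalPhysics.QuantumFieldTheory.Luscher2010.FlowActionSeriesProofs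
import Literature.MathematicalPhysics.QuantumLattice.RepLieAlgebraUnitary
import Summits.Ventures.LatticeQCDFlow.Scaling.ExtensiveSpecificHeat
import Summits.Ventures.LatticeQCDFlow.Scaling.SchwingerDysonVarianceFloor
import HarnessLib

/-!
HONEST FRAMING: exact (Metropolis-corrected) sampling algorithms for lattice gauge theory; figures
of merit are autocorrelation/cost numbers at stated couplings and volumes; no continuum-physics
claim.

# WilsonSpecificHeatFloorDeriv — VOLUME-UNIFORM BOUNDS ON THE FIRST THREE LINK DERIVATIVES OF `S_W`
# AND LINK LOCALITY ON THE EVEN FAMILY (theory2 item 128, PART 2 of 4: §B1–§B4)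

CUSTODY: theory2 item 128 (GEN-41, HOME tier) re-landed by lean-2 GEN-10 per LEAD LINE 255 RL-47 (116);
statements and proofs = HOME/lean/theory2/WilsonSpecificHeatFloor.lean 07cab9e5ed9822d9 (1 031 l)
verbatim, split below the `lint.size` line into FOUR files (`WilsonSpecificHeatFloorShift` §A,
`WilsonSpecificHeatFloorDeriv` §B1–§B4, `WilsonSpecificHeatFloorCasimir` §C–§D,
`WilsonSpecificHeatFloor` §E–§F; parts 1–3 are mutually independent, part 4 imports them); headers
trimmed; imports = HOME's (its three `Scaling.*` placeholder lines ARE the tree module names of items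
125 / 126 / 127 as landed by lean-2 GEN-9) minus item 125, which only PART 4 §F needs; landing edits:
docstrings added where the lint asks (builder `build128.py` in the custodian's seat folder).

THEORY-2 item 128 (theory2 GEN-41; cell pub-lqcd / Ventures/LatticeQCDFlow).  Main theorem of the
series (`wilsonSpecificHeatFloorUniform`, PART 4): pure `SU(n)` Wilson theory on the torus `(ℤ/L)^d`;
for `n ≥ 2`, `d ≥ 2`, `β₀ > 0` there is `c = c(d, n, β₀) > 0` with
`Var_{π_u}(S_W) ≥ c · #plaquettes(d, L) / u²` for every `L ≥ 2` and every `u ≥ β₀` — item 125's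
conjecture (SH_W), uniform in the volume, hence item 125's `log² R` layer laws unconditional.

This part (§B = inputs (BND) and (LOC) of item 127's Schwinger–Dyson floor): §B1 slot derivatives
`D_{s,Y} g` of functions of four free links and the chain rule `∂_{e,Y}(g ∘ P) = (D_{s(e),Y} g) ∘ P`
through the plaquette projection (`linkDeriv_comp_plaqProj`); §B2 a finite family of continuous
functions is uniformly bounded on the compact set `SU(n)^4` (`exists_uniform_bound`); §B3 the first
three link derivatives of `S_W` along a finite family `Y` as plaquette sums of slot derivatives of the
fixed four-link function `refPlaq` (tree `WilsonGradientBound`), whence **`wilson_deriv_bounds`**: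
constants `c₁, c₂ ≥ 1, c₃`, depending on `d`, `n`, `Y` only, bounding `|∂_{e,a}S_W|`,
`|∂_{e,a}∂_{e,b}S_W|`, `|∂_{e,a}∂_{e,b}∂_{e,b}S_W|` on `SU(n)^E` in EVERY volume; §B4 no plaquette
contains two distinct links of the tree's even family `evenLinks μ` (`evenLinks_not_both_mem`), so the
mixed second / third derivatives of `S_W` at distinct even links vanish (`wilson_loc₁`, `wilson_loc₂`).
-/

noncomputable section

set_option linter.unusedSectionVars false

namespace Summit.Ventures.LatticeQCDFlow.Theory2.WilsonSpecificHeat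

open MeasureTheory ProbabilityTheory
open Literature.MathematicalPhysics.QuantumFieldTheory
open Literature.MathematicalPhysics.QuantumFieldTheory.Luscher2010
open Literature.MathematicalPhysics.QuantumFieldTheory.WilsonFlow (coeConfig continuous_coeConfig
  coeConfig_apply)
open Summit.Ventures.LatticeQCDFlow.TrivializingMaps
open Summit.Ventures.LatticeQCDFlow.Theory2.SchwingerDyson (dirLap)
open scoped Matrix Matrix.Norms.Frobenius ContDiff

variable {d L n : ℕ}

/-! ## §B1. Slot derivatives of functions of four free links -/

section Slot

/-- The tangent vector of left multiplication by `Y` on the slots `s ⊆ {0,1,2,3}`: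
`(σ_{s,Y} A)_i = Y·A_i` for `i ∈ s`, else `0`. [folklore] -/
def slotVec (s : Finset (Fin 4)) (Y : Matrix (Fin n) (Fin n) ℂ)
    (A : Fin 4 → Matrix (Fin n) (Fin n) ℂ) : Fin 4 → Matrix (Fin n) (Fin n) ℂ :=
  fun i => if i ∈ s then Y * A i else 0

/-- The slot derivative `D_{s,Y} g (A) = Dg(A)[σ_{s,Y} A]`. [folklore] -/
def slotD (s : Finset (Fin 4)) (Y : Matrix (Fin n) (Fin n) ℂ)
    (g : (Fin 4 → Matrix (Fin n) (Fin n) ℂ) → ℝ) (A : Fin 4 → Matrix (Fin n) (Fin n) ℂ) : ℝ :=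
  fderiv ℝ g A (slotVec s Y A)

/-- The slot tangent field `σ_{s,Y}` is smooth. [folklore] -/
theorem contDiff_slotVec (s : Finset (Fin 4)) (Y : Matrix (Fin n) (Fin n) ℂ) :
    ContDiff ℝ ∞ (slotVec (n := n) s Y) := by
  unfold slotVec
  refine contDiff_pi.2 fun i => ?_
  by_cases h : i ∈ s
  · simp only [h, if_true]
    exact contDiff_const.mul (contDiff_apply ℝ (Matrix (Fin n) (Fin n) ℂ) i)
  · simp only [h, if_false]
    exact contDiff_const

/-- Slot derivatives of smooth functions are smooth. [folklore] -/
theorem contDiff_slotD (s : Finset (Fin 4)) (Y : Matrix (Fin n) (Fin n) ℂ)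
    {g : (Fin 4 → Matrix (Fin n) (Fin n) ℂ) → ℝ} (hg : ContDiff ℝ ∞ g) :
    ContDiff ℝ ∞ (slotD s Y g) := by
  unfold slotD
  exact (hg.fderiv_right (m := ∞) le_rfl).clm_apply (contDiff_slotVec s Y)

variable [NeZero L]

/-- The slots of the plaquette `(x; μ, ν)` occupied by the link `e`. [folklore] -/
def slots (x : Site d L) (μ ν : Fin d) (e : Edge d L) : Finset (Fin 4) :=
  Finset.univ.filter fun i => plaqIdx x μ ν i = e

/-- **Chain rule**: a link derivative of a function of the four plaquette links is the corresponding
slot derivative, read at the plaquette links: `∂_{e,Y}(g ∘ P) = (D_{s(e),Y} g) ∘ P`. [folklore] -/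
theorem linkDeriv_comp_plaqProj {g : (Fin 4 → Matrix (Fin n) (Fin n) ℂ) → ℝ} (hg : ContDiff ℝ ∞ g)
    (x : Site d L) (μ ν : Fin d) (e : Edge d L) (Y : Matrix (Fin n) (Fin n) ℂ) :
    linkDeriv e Y (g ∘ ⇑(plaqProj (n := n) x μ ν)) =
      slotD (slots x μ ν e) Y g ∘ ⇑(plaqProj x μ ν) := by
  funext W
  have hQ : DifferentiableAt ℝ g (plaqProj x μ ν W) := (hg.differentiable (by simp)) _
  have hd : HasFDerivAt (g ∘ ⇑(plaqProj (n := n) x μ ν))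
      ((fderiv ℝ g (plaqProj x μ ν W)).comp (plaqProj x μ ν)) W :=
    hQ.hasFDerivAt.comp _ (plaqProj x μ ν).hasFDerivAt
  rw [linkDeriv_eq_fderiv hd.differentiableAt, hd.fderiv, ContinuousLinearMap.comp_apply,
    Function.comp_apply, slotD]
  congr 1
  funext i
  simp only [plaqProj_apply, slotVec, slots, Finset.mem_filter, Finset.mem_univ, true_and,
    Pi.single_apply]
  by_cases h : plaqIdx x μ ν i = e
  · rw [if_pos h, if_pos h, h]
  · rw [if_neg h, if_neg h]

end Slot

/-! ## §B2. Uniform bounds on compact sets of link values -/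

section Bounds

/-- The set of special-unitary four-link values (compact). [folklore] -/
def suBox (n : ℕ) : Set (Fin 4 → Matrix (Fin n) (Fin n) ℂ) :=
  Set.pi Set.univ fun _ : Fin 4 =>
    Set.range (Subtype.val : ↥(Matrix.specialUnitaryGroup (Fin n) ℂ) → Matrix (Fin n) (Fin n) ℂ)

/-- `SU(n)^4` is compact. [folklore] -/
theorem isCompact_suBox : IsCompact (suBox n) :=
  isCompact_univ_pi fun _ => isCompact_range continuous_subtype_val

/-- **A finite family of continuous functions is uniformly bounded on `SU(n)^4`.** [folklore] -/
theorem exists_uniform_bound {κ : Type*} [Fintype κ]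
    (G : κ → (Fin 4 → Matrix (Fin n) (Fin n) ℂ) → ℝ) (hG : ∀ k, Continuous (G k)) :
    ∃ K : ℝ, 0 ≤ K ∧ ∀ k A, A ∈ suBox n → |G k A| ≤ K := by
  have hb : ∀ k, ∃ Kk : ℝ, ∀ A ∈ suBox n, ‖G k A‖ ≤ Kk := fun k =>
    isCompact_suBox.exists_bound_of_continuousOn (hG k).continuousOn
  choose Kk hKk using hb
  refine ⟨∑ k, |Kk k|, Finset.sum_nonneg fun k _ => abs_nonneg _, fun k A hA => ?_⟩
  calc |G k A| = ‖G k A‖ := (Real.norm_eq_abs _).symm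
    _ ≤ Kk k := hKk k A hA
    _ ≤ |Kk k| := le_abs_self _
    _ ≤ ∑ k, |Kk k| := Finset.single_le_sum (fun k _ => abs_nonneg (Kk k)) (Finset.mem_univ k)

variable [NeZero L]

/-- The plaquette links of a special-unitary configuration lie in `SU(n)^4`. [folklore] -/
theorem plaqProj_coeConfig_mem (x : Site d L) (μ ν : Fin d)
    (U : GaugeConfig d L ↥(Matrix.specialUnitaryGroup (Fin n) ℂ)) :
    plaqProj x μ ν (coeConfig U) ∈ suBox n :=
  Set.mem_univ_pi.2 fun i => ⟨U (plaqIdx x μ ν i), rfl⟩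

end Bounds

/-! ## §B3. The first three link derivatives of `S_W` along a family `Y` -/

section Wilson

variable [NeZero L] {ι : Type*} [Fintype ι] (Y : ι → Matrix (Fin n) (Fin n) ℂ)

/-- first slot derivatives of the reference plaquette -/
def G₁ (Y : ι → Matrix (Fin n) (Fin n) ℂ) (k : Finset (Fin 4) × ι) :
    (Fin 4 → Matrix (Fin n) (Fin n) ℂ) → ℝ :=
  slotD k.1 (Y k.2) (refPlaq n)

/-- second slot derivatives of the reference plaquette -/
def G₂ (Y : ι → Matrix (Fin n) (Fin n) ℂ) (k : Finset (Fin 4) × ι × ι) :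
    (Fin 4 → Matrix (Fin n) (Fin n) ℂ) → ℝ :=
  slotD k.1 (Y k.2.1) (slotD k.1 (Y k.2.2) (refPlaq n))

/-- third slot derivatives of the reference plaquette -/
def G₃ (Y : ι → Matrix (Fin n) (Fin n) ℂ) (k : Finset (Fin 4) × ι × ι) :
    (Fin 4 → Matrix (Fin n) (Fin n) ℂ) → ℝ :=
  slotD k.1 (Y k.2.1) (slotD k.1 (Y k.2.2) (slotD k.1 (Y k.2.2) (refPlaq n)))

/-- The first slot derivatives of the reference plaquette are smooth. [folklore] -/
theorem contDiff_G₁ (k : Finset (Fin 4) × ι) : ContDiff ℝ ∞ (G₁ Y k) :=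
  contDiff_slotD _ _ contDiff_refPlaq

/-- The second slot derivatives of the reference plaquette are smooth. [folklore] -/
theorem contDiff_G₂ (k : Finset (Fin 4) × ι × ι) : ContDiff ℝ ∞ (G₂ Y k) :=
  contDiff_slotD _ _ (contDiff_slotD _ _ contDiff_refPlaq)

/-- The third slot derivatives of the reference plaquette are smooth. [folklore] -/
theorem contDiff_G₃ (k : Finset (Fin 4) × ι × ι) : ContDiff ℝ ∞ (G₃ Y k) :=
  contDiff_slotD _ _ (contDiff_slotD _ _ (contDiff_slotD _ _ contDiff_refPlaq))

/-- `∂_{e,a} plaqRe = G₁ ∘ P`. -/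
theorem linkDeriv_plaqRe_eq (x : Site d L) (μ ν : Fin d) (e : Edge d L) (a : ι) :
    linkDeriv e (Y a) (plaqRe (n := n) x μ ν) = G₁ Y (slots x μ ν e, a) ∘ ⇑(plaqProj x μ ν) := by
  rw [plaqRe_eq_comp, linkDeriv_comp_plaqProj contDiff_refPlaq]
  rfl

/-- `∂_{e,a}∂_{e,b} plaqRe = G₂ ∘ P`. -/
theorem linkDeriv₂_plaqRe_eq (x : Site d L) (μ ν : Fin d) (e : Edge d L) (a b : ι) :
    linkDeriv e (Y a) (linkDeriv e (Y b) (plaqRe (n := n) x μ ν)) =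
      G₂ Y (slots x μ ν e, a, b) ∘ ⇑(plaqProj x μ ν) := by
  rw [linkDeriv_plaqRe_eq, G₁, linkDeriv_comp_plaqProj (contDiff_slotD _ _ contDiff_refPlaq)]
  rfl

/-- `∂_{e,a}∂_{e,b}∂_{e,b} plaqRe = G₃ ∘ P`. -/
theorem linkDeriv₃_plaqRe_eq (x : Site d L) (μ ν : Fin d) (e : Edge d L) (a b : ι) :
    linkDeriv e (Y a) (linkDeriv e (Y b) (linkDeriv e (Y b) (plaqRe (n := n) x μ ν))) =
      G₃ Y (slots x μ ν e, a, b) ∘ ⇑(plaqProj x μ ν) := by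
  rw [linkDeriv₂_plaqRe_eq, G₂,
    linkDeriv_comp_plaqProj (contDiff_slotD _ _ (contDiff_slotD _ _ contDiff_refPlaq))]
  rfl

/-- `∂_{e,b} plaqTerm p` as a function. -/
theorem linkDeriv_plaqTerm (e : Edge d L) (b : ι) (p : Site d L × Fin d × Fin d) :
    linkDeriv e (Y b) (plaqTerm (n := n) p) =
      if p.2.1 < p.2.2 then linkDeriv e (Y b) (plaqRe p.1 p.2.1 p.2.2) else fun _ => 0 := by
  by_cases h : p.2.1 < p.2.2
  · rw [plaqTerm_of_lt h, if_pos h]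
  · rw [plaqTerm_of_not_lt h, if_neg h, linkDeriv_const]

/-- `∂_{e,a} S_W = Σ_p ∂_{e,a} plaqTerm p` (as functions). -/
theorem linkDeriv_ambWilsonAction_eq (e : Edge d L) (a : ι) :
    linkDeriv e (Y a) (ambWilsonAction : AmbConfig d L n → ℝ) =
      fun W => ∑ p : Site d L × Fin d × Fin d, linkDeriv e (Y a) (plaqTerm p) W := by
  rw [ambWilsonAction_eq_sum_plaqTerm]
  exact linkDeriv_finset_sum e (Y a) Finset.univ (fun p => plaqTerm p) fun p _ =>
    contDiff_plaqTerm p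

/-- `∂_{e,a}∂_{e',b} S_W = Σ_p ∂_{e,a}∂_{e',b} plaqTerm p` (as functions). -/
theorem linkDeriv₂_ambWilsonAction_eq (e e' : Edge d L) (a b : ι) :
    linkDeriv e (Y a) (linkDeriv e' (Y b) (ambWilsonAction : AmbConfig d L n → ℝ)) =
      fun W => ∑ p : Site d L × Fin d × Fin d,
        linkDeriv e (Y a) (linkDeriv e' (Y b) (plaqTerm p)) W := by
  rw [linkDeriv_ambWilsonAction_eq]
  exact linkDeriv_finset_sum e (Y a) Finset.univ (fun p => linkDeriv e' (Y b) (plaqTerm p))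
    fun p _ => contDiff_linkDeriv (contDiff_plaqTerm p) e' (Y b)

/-- `∂_{e,a}∂_{e',b}∂_{e'',c} S_W = Σ_p …` (as functions). -/
theorem linkDeriv₃_ambWilsonAction_eq (e e' e'' : Edge d L) (a b c : ι) :
    linkDeriv e (Y a) (linkDeriv e' (Y b) (linkDeriv e'' (Y c)
      (ambWilsonAction : AmbConfig d L n → ℝ))) =
      fun W => ∑ p : Site d L × Fin d × Fin d,
        linkDeriv e (Y a) (linkDeriv e' (Y b) (linkDeriv e'' (Y c) (plaqTerm p))) W := by
  rw [linkDeriv₂_ambWilsonAction_eq]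
  exact linkDeriv_finset_sum e (Y a) Finset.univ
    (fun p => linkDeriv e' (Y b) (linkDeriv e'' (Y c) (plaqTerm p)))
    fun p _ => contDiff_linkDeriv (contDiff_linkDeriv (contDiff_plaqTerm p) e'' (Y c)) e' (Y b)

/-- A plaquette term not containing `e` has vanishing `e`-derivative (as a function). -/
theorem linkDeriv_plaqTerm_eq_zero (e : Edge d L) (b : ι) {p : Site d L × Fin d × Fin d}
    (hp : e ∉ Luscher2010.plaqLinks p.1 p.2.1 p.2.2) :
    linkDeriv e (Y b) (plaqTerm (n := n) p) = fun _ => 0 := by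
  rw [linkDeriv_plaqTerm]
  by_cases h : p.2.1 < p.2.2
  · rw [if_pos h]
    exact linkDeriv_eq_zero_of_not_mem (Y b) (plaqRe_mem p.1 p.2.1 p.2.2).2 hp
  · rw [if_neg h]

/-- **Volume-uniform bounds on the first three link derivatives of `S_W` along a finite family
`Y`.**
There are `c₁, c₂, c₃ ≥ 0`, depending on `d`, `n` and `Y` only, with
`|∂_{e,a}S_W| ≤ c₁`, `|∂_{e,a}∂_{e,b}S_W| ≤ c₂`, `|∂_{e,a}∂_{e,b}∂_{e,b}S_W| ≤ c₃` on `SU(n)^E`,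
for every `L`, every link `e` and all `a, b`. [folklore; chain rule through the fixed four-link
function `refPlaq` (tree `WilsonGradientBound`) + compactness of `SU(n)^4`] -/
theorem wilson_deriv_bounds (d n : ℕ) {ι : Type*} [Fintype ι] (Y : ι → Matrix (Fin n) (Fin n) ℂ) :
    ∃ c₁ c₂ c₃ : ℝ, 0 ≤ c₁ ∧ 1 ≤ c₂ ∧ 0 ≤ c₃ ∧ ∀ (L : ℕ) [NeZero L]
      (U : GaugeConfig d L ↥(Matrix.specialUnitaryGroup (Fin n) ℂ)) (e : Edge d L) (a b : ι),
      |linkDeriv e (Y a) (ambWilsonAction : AmbConfig d L n → ℝ) (coeConfig U)| ≤ c₁ ∧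
      |linkDeriv e (Y a) (linkDeriv e (Y b) (ambWilsonAction : AmbConfig d L n → ℝ))
          (coeConfig U)| ≤ c₂ ∧
      |linkDeriv e (Y a) (linkDeriv e (Y b) (linkDeriv e (Y b)
          (ambWilsonAction : AmbConfig d L n → ℝ))) (coeConfig U)| ≤ c₃ := by
  obtain ⟨K₁, hK₁0, hK₁⟩ := exists_uniform_bound (G₁ Y) fun k => (contDiff_G₁ Y k).continuous
  obtain ⟨K₂, hK₂0, hK₂⟩ := exists_uniform_bound (G₂ Y) fun k => (contDiff_G₂ Y k).continuous
  obtain ⟨K₃, hK₃0, hK₃⟩ := exists_uniform_bound (G₃ Y) fun k => (contDiff_G₃ Y k).continuous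
  refine ⟨4 * (d * d) * K₁, max (4 * (d * d) * K₂) 1, 4 * (d * d) * K₃, by positivity,
    le_max_right _ _, by positivity, fun L _ U e a b => ⟨?_, ?_, ?_⟩⟩
  · rw [linkDeriv_ambWilsonAction_eq]
    refine abs_sum_plaq_le e _ hK₁0 (fun p hp => ?_) (fun p => ?_)
    · rw [linkDeriv_plaqTerm_eq_zero Y e a hp]
    · rw [linkDeriv_plaqTerm]
      by_cases h : p.2.1 < p.2.2
      · rw [if_pos h, linkDeriv_plaqRe_eq, Function.comp_apply]
        exact hK₁ _ _ (plaqProj_coeConfig_mem _ _ _ U)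
      · rw [if_neg h, abs_zero]; exact hK₁0
  · refine le_trans ?_ (le_max_left _ _)
    rw [linkDeriv₂_ambWilsonAction_eq]
    refine abs_sum_plaq_le e _ hK₂0 (fun p hp => ?_) (fun p => ?_)
    · rw [linkDeriv_plaqTerm_eq_zero Y e b hp, linkDeriv_const]
    · rw [linkDeriv_plaqTerm]
      by_cases h : p.2.1 < p.2.2
      · rw [if_pos h, linkDeriv₂_plaqRe_eq, Function.comp_apply]
        exact hK₂ _ _ (plaqProj_coeConfig_mem _ _ _ U)
      · rw [if_neg h, linkDeriv_const, abs_zero]; exact hK₂0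
  · rw [linkDeriv₃_ambWilsonAction_eq]
    refine abs_sum_plaq_le e _ hK₃0 (fun p hp => ?_) (fun p => ?_)
    · rw [linkDeriv_plaqTerm_eq_zero Y e b hp, linkDeriv_const, linkDeriv_const]
    · rw [linkDeriv_plaqTerm]
      by_cases h : p.2.1 < p.2.2
      · rw [if_pos h, linkDeriv₃_plaqRe_eq, Function.comp_apply]
        exact hK₃ _ _ (plaqProj_coeConfig_mem _ _ _ U)
      · rw [if_neg h, linkDeriv_const, linkDeriv_const, abs_zero]; exact hK₃0

end Wilson

/-! ## §B4. Link locality: distinct links of the even family -/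

section Locality

variable [NeZero L] {ι : Type*} [Fintype ι] (Y : ι → Matrix (Fin n) (Fin n) ℂ)

/-- The tree's two spellings of "the four links of a plaquette" agree. [folklore] -/
theorem mem_plaqLinks_set_iff (x : Site d L) {μ ν : Fin d} (hμν : μ < ν) (e : Edge d L) :
    e ∈ Luscher2010.plaqLinks x μ ν ↔
      e ∈ TrivializingMaps.plaqLinks ((x, ⟨(μ, ν), hμν⟩) : Plaquette d L) := by
  rw [mem_plaqLinks_iff]
  simp only [Luscher2010.plaqLinks, Set.mem_insert_iff, Set.mem_singleton_iff]

/-- **The even link family is non-interacting**: no plaquette contains two distinct even links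
(tree `evenLinks_pairwise`, restated through the link sets `Luscher2010.plaqLinks x μ ν`). [ours] -/
theorem evenLinks_not_both_mem (i₀ : Fin d) {e e' : Edge d L} (he : e ∈ evenLinks i₀)
    (he' : e' ∈ evenLinks i₀) (hne : e ≠ e') (x : Site d L) {μ ν : Fin d} (hμν : μ < ν)
    (hex : e ∈ Luscher2010.plaqLinks x μ ν) : e' ∉ Luscher2010.plaqLinks x μ ν := fun he'x =>
  evenLinks_pairwise i₀ he he' hne ((x, ⟨(μ, ν), hμν⟩) : Plaquette d L)
    ((mem_plaqLinks_set_iff x hμν e).1 hex) ((mem_plaqLinks_set_iff x hμν e').1 he'x)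

/-- Mixed second link derivatives of a plaquette-local functional at two distinct even links
vanish. [folklore] -/
theorem linkDeriv_linkDeriv_eq_zero_of_local (i₀ : Fin d) {e e' : Edge d L}
    (he : e ∈ evenLinks i₀) (he' : e' ∈ evenLinks i₀) (hne : e ≠ e') {x : Site d L} {μ ν : Fin d}
    (hμν : μ < ν) {F : AmbConfig d L n → ℝ} (hF : F ∈ PD 4 (Luscher2010.plaqLinks x μ ν))
    (X X' : Matrix (Fin n) (Fin n) ℂ) :
    linkDeriv e X (linkDeriv e' X' F) = fun _ => 0 := by
  by_cases h' : e' ∈ Luscher2010.plaqLinks x μ ν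
  · have hex : e ∉ Luscher2010.plaqLinks x μ ν :=
      evenLinks_not_both_mem i₀ he' he hne.symm x hμν h'
    exact linkDeriv_eq_zero_of_not_mem X (linkDeriv_mem_PD e' X' hF).2 hex
  · rw [linkDeriv_eq_zero_of_not_mem X' hF.2 h', linkDeriv_const]

/-- **Locality (i)**: `∂_{e,a}∂_{e',b} S_W ≡ 0` for distinct even links `e ≠ e'`. [ours] -/
theorem wilson_loc₁ (i₀ : Fin d) :
    ∀ e ∈ evenLinks i₀, ∀ e' ∈ evenLinks i₀, e ≠ e' → ∀ a b (W : AmbConfig d L n),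
      linkDeriv e (Y a) (linkDeriv e' (Y b) (ambWilsonAction : AmbConfig d L n → ℝ)) W = 0 := by
  intro e he e' he' hne a b W
  rw [linkDeriv₂_ambWilsonAction_eq]
  refine Finset.sum_eq_zero fun p _ => ?_
  rw [linkDeriv_plaqTerm]
  by_cases h : p.2.1 < p.2.2
  · rw [if_pos h,
      linkDeriv_linkDeriv_eq_zero_of_local i₀ he he' hne h (plaqRe_mem p.1 p.2.1 p.2.2)]
  · rw [if_neg h, linkDeriv_const]

/-- **Locality (ii)**: `∂_{e,a}∂_{e',b}∂_{e',b} S_W ≡ 0` for distinct even links `e ≠ e'`. [ours] -/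
theorem wilson_loc₂ (i₀ : Fin d) :
    ∀ e ∈ evenLinks i₀, ∀ e' ∈ evenLinks i₀, e ≠ e' → ∀ a b (W : AmbConfig d L n),
      linkDeriv e (Y a) (linkDeriv e' (Y b) (linkDeriv e' (Y b)
        (ambWilsonAction : AmbConfig d L n → ℝ))) W = 0 := by
  intro e he e' he' hne a b W
  rw [linkDeriv₃_ambWilsonAction_eq]
  refine Finset.sum_eq_zero fun p _ => ?_
  rw [linkDeriv_plaqTerm]
  by_cases h : p.2.1 < p.2.2
  · rw [if_pos h, linkDeriv_linkDeriv_eq_zero_of_local i₀ he he' hne h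
      (linkDeriv_mem_PD e' (Y b) (plaqRe_mem p.1 p.2.1 p.2.2))]
  · rw [if_neg h, linkDeriv_const, linkDeriv_const]

end Locality

end Summit.Ventures.LatticeQCDFlow.Theory2.WilsonSpecificHeat

end
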